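import Mathlib
import HarnessLib
import Literature.Analysis.FluidPDE.TypeIAncientMild

/-!
# Far-past ledger, mean displacement: analytic tools — crux stmt-NavierStokesRegularity-14060
(`SymmetryModuliCount.FarPastLedger`), line `uloc-gronwall-transplant`, stub `stub_fplMeanDisplacement`

Helper file (theorems only, any finite-dimensional real inner product space `E`) for the
registered stub MD `stub_fplMeanDisplacement` of line `uloc-gronwall-transplant`, proved in the main
file `SymmetryModuliCountFarPastLedgerMeanDisplacement.lean` (the bump-averaged displacement
`r⁻³∫θ(x/r)(u(t₂,x) − u(t₁,x))dx → 0` of a Type I ancient mild field). The two halves of the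
tested Oseen identity are estimated here through the `L¹` modulus of continuity
`ω(z) = ∫|g(y + z) − g(y)|dy` of the scalar test function `g` (`= θ(·/r)` in the main file):

* `fpl_meanDisp_lintegral_shift_sub_le` — `ω(z) ≤ m · 2|B|` if `g` is supported in `B` and the
  increment is bounded by `m`;
* `fpl_meanDisp_caloric_le` — the caloric part `|∫⟪f, e^{δΔ}(g v) − g v⟫|` for bounded `f`
  (`e^{δΔ}w − w = ∫G_δ(z)(w(· − z) − w)dz`, Tonelli, first Gaussian moment);
* `fpl_meanDisp_oseen_slice_le` — one time slice of the Duhamel part,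
  `∫|∫⟪K(σ, x − y)[a(y), a(y)], g(x)v⟫dx|dy`, via the **zero mean of the Oseen kernel**
  (`integral_oseenKernel_eq_zero`, the reason constants are Oseen-mild), Koch–Tataru's bound
  `|K(σ,z)| ≤ C(σ + |z|²)^{-(d+1)/2}` and `∫(σ + |z|²)^{-(d/2+1/4)}dz = cσ^{-1/4}`;
* `stub_fplMeanDisplacementTools` — the registered sub-goal of the crux item this file closes: the
  two estimates specialised verbatim to `ℝ³`.

Sources: H. Koch, D. Tataru, Adv. Math. 157 (2001), (8), (14) (the tree's `KochTataruKernel.lean`,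
`KNSSRemark61.lean`); Gaussian moments from `HeatKernelBoundedData.lean`.
-/

noncomputable section

set_option linter.dupNamespace false -- nested layout Summit.<S>.<Sub>, Sub = S (D-0017)

open MeasureTheory Set Filter Topology Function Metric
open Literature.Analysis.FluidPDE Literature.Analysis.UnboundedOperators
open scoped RealInnerProductSpace ENNReal NNReal

namespace Summit.NavierStokesRegularity.NavierStokesRegularity.Theorems

variable {E : Type*} [NormedAddCommGroup E] [InnerProductSpace ℝ E] [FiniteDimensional ℝ E]
  [MeasurableSpace E] [BorelSpace E]

/-! ### The `L¹` modulus of continuity of a function supported in a set of finite measure -/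

/-- If `g` is supported in `B` and the increment `g(· + z) − g` is bounded by `m`, then
`∫ |g(y + z) − g(y)| dy ≤ m · 2|B|` (the increment lives on `(B − z) ∪ B`). [folklore] -/
theorem fpl_meanDisp_lintegral_shift_sub_le {g : E → ℝ} {B : Set E} (hg : support g ⊆ B)
    (z : E) {m : ℝ} (hm : ∀ y, |g (y + z) - g y| ≤ m) :
    ∫⁻ y, ‖g (y + z) - g y‖ₑ ≤ ENNReal.ofReal m * (2 * volume B) := by
  set A : Set E := (fun y => y + z) ⁻¹' B ∪ B with hA
  have hle : ∀ y, ‖g (y + z) - g y‖ₑ ≤ A.indicator (fun _ => ENNReal.ofReal m) y := by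
    intro y
    by_cases hy : y ∈ A
    · rw [indicator_of_mem hy, Real.enorm_eq_ofReal_abs]
      exact ENNReal.ofReal_le_ofReal (hm y)
    · rw [hA, mem_union, not_or, mem_preimage] at hy
      have h1 : g (y + z) = 0 := notMem_support.1 fun h => hy.1 (hg h)
      have h2 : g y = 0 := notMem_support.1 fun h => hy.2 (hg h)
      rw [h1, h2, sub_zero, enorm_zero]
      exact zero_le
  calc ∫⁻ y, ‖g (y + z) - g y‖ₑ ≤ ∫⁻ y, A.indicator (fun _ => ENNReal.ofReal m) y :=
        lintegral_mono hle
    _ ≤ ENNReal.ofReal m * volume A := lintegral_indicator_const_le _ _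
    _ ≤ ENNReal.ofReal m * (2 * volume B) := by
        gcongr
        calc volume A ≤ volume ((fun y => y + z) ⁻¹' B) + volume B := measure_union_le _ _
          _ = 2 * volume B := by rw [measure_preimage_add_right, two_mul]

/-! ### The caloric part: `∫⟪f, e^{δΔ}(g v) − g v⟫` for bounded `f` and Lipschitz `g` -/

/-- **Caloric estimate.** For `f` bounded by `M₁`, `g` continuous with `|g| ≤ 1`, supported in
`B`, with increments `|g(y + z) − g(y)| ≤ Λ|z|`, and a vector `v`:
`|∫⟪f, e^{δΔ}(g v) − g v⟫| ≤ M₁ |v| Λ · (2·2^{d/2} δ^{1/2}) · 2|B|`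
(`e^{δΔ}w − w = ∫ G_δ(z)(w(· − z) − w) dz`, Tonelli, the `L¹` modulus of `g`, and the first Gaussian
moment `∫ G_δ|z| ≤ 2·2^{d/2}δ^{1/2}`). [folklore] -/
theorem fpl_meanDisp_caloric_le {f : E → E} {M₁ : ℝ} (hM₁ : 0 ≤ M₁) (hf : ∀ x, ‖f x‖ ≤ M₁)
    {g : E → ℝ} (hgc : Continuous g) {B : Set E} (hgB : support g ⊆ B) {Λ : ℝ} (hΛ : 0 ≤ Λ)
    (hgΛ : ∀ y z, |g (y + z) - g y| ≤ Λ * ‖z‖) (hg1 : ∀ y, |g y| ≤ 1) (v : E) {δ : ℝ}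
    (hδ : 0 < δ) :
    ‖∫ x, ⟪f x, heatExtension (fun y => g y • v) δ x - g x • v⟫‖ₑ ≤
      ENNReal.ofReal (M₁ * ‖v‖ * Λ *
        (2 * (2 : ℝ) ^ ((Module.finrank ℝ E : ℝ) / 2) * δ ^ (1 / 2 : ℝ))) * (2 * volume B) := by
  haveI : CompleteSpace E := FiniteDimensional.complete ℝ E
  set m₁ : ℝ := 2 * (2 : ℝ) ^ ((Module.finrank ℝ E : ℝ) / 2) * δ ^ (1 / 2 : ℝ) with hm₁
  have hwc : Continuous (fun y => g y • v) := hgc.smul continuous_const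
  have hwb : ∀ y, ‖g y • v‖ ≤ ‖v‖ := fun y => by
    rw [norm_smul, Real.norm_eq_abs]
    calc |g y| * ‖v‖ ≤ 1 * ‖v‖ := by gcongr; exact hg1 y
      _ = ‖v‖ := one_mul _
  -- the increment representation of `e^{δΔ}w - w`
  have hrep : ∀ x, heatExtension (fun y => g y • v) δ x - g x • v =
      ∫ z, heatKernel δ z • (g (x - z) • v - g x • v) :=
    fun x => heatExtension_sub_self_eq_integral hwc hwb hδ x
  -- pointwise majorant in `x`
  have h1 : ∀ x, ‖⟪f x, heatExtension (fun y => g y • v) δ x - g x • v⟫‖ₑ ≤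
      ENNReal.ofReal M₁ *
        ∫⁻ z, ENNReal.ofReal (heatKernel δ z) * (‖g (x - z) - g x‖ₑ * ‖v‖ₑ) := by
    intro x
    calc ‖⟪f x, heatExtension (fun y => g y • v) δ x - g x • v⟫‖ₑ
        ≤ ‖f x‖ₑ * ‖heatExtension (fun y => g y • v) δ x - g x • v‖ₑ := by
          rw [← ofReal_norm, ← ofReal_norm, ← ofReal_norm, ← ENNReal.ofReal_mul (norm_nonneg _)]
          exact ENNReal.ofReal_le_ofReal (norm_inner_le_norm _ _)
      _ ≤ ENNReal.ofReal M₁ * ‖∫ z, heatKernel δ z • (g (x - z) • v - g x • v)‖ₑ := by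
          rw [hrep x]
          gcongr
          rw [← ofReal_norm]
          exact ENNReal.ofReal_le_ofReal (hf x)
      _ ≤ ENNReal.ofReal M₁ * ∫⁻ z, ‖heatKernel δ z • (g (x - z) • v - g x • v)‖ₑ := by
          gcongr
          exact enorm_integral_le_lintegral_enorm _
      _ = _ := by
          congr 1
          refine lintegral_congr fun z => ?_
          rw [enorm_smul, Real.enorm_eq_ofReal (heatKernel_pos hδ z).le, ← sub_smul, enorm_smul]
  -- measurability for Tonelli
  have hmeas : AEMeasurable (uncurry fun (x z : E) =>
      ENNReal.ofReal (heatKernel δ z) * (‖g (x - z) - g x‖ₑ * ‖v‖ₑ))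
      ((volume : Measure E).prod volume) := by
    refine Measurable.aemeasurable ?_
    refine ((continuous_heatKernel δ).comp continuous_snd).measurable.ennreal_ofReal.mul
      ((Continuous.measurable ?_).enorm.mul measurable_const)
    exact (hgc.comp (continuous_fst.sub continuous_snd)).sub (hgc.comp continuous_fst)
  -- the `x`-integral of the increment: the `L¹` modulus
  have h2 : ∀ z, ∫⁻ x, ENNReal.ofReal (heatKernel δ z) * (‖g (x - z) - g x‖ₑ * ‖v‖ₑ) ≤
      ENNReal.ofReal (heatKernel δ z) * (ENNReal.ofReal (Λ * ‖z‖) * (2 * volume B) * ‖v‖ₑ) := by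
    intro z
    have hmz : Measurable fun x => ‖g (x - z) - g x‖ₑ :=
      ((hgc.comp (continuous_id.sub continuous_const)).sub hgc).measurable.enorm
    rw [lintegral_const_mul _ (hmz.mul_const _), lintegral_mul_const _ hmz]
    gcongr
    have h := fpl_meanDisp_lintegral_shift_sub_le hgB (-z) (m := Λ * ‖z‖) (fun y => by
      simpa only [norm_neg, ← sub_eq_add_neg] using hgΛ y (-z))
    simpa only [← sub_eq_add_neg] using h
  have hGm : Measurable fun z : E => ENNReal.ofReal (heatKernel δ z * ‖z‖) :=
    ((continuous_heatKernel δ).mul continuous_norm).measurable.ennreal_ofReal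
  have e : ENNReal.ofReal (M₁ * ‖v‖ * Λ * m₁) =
      ENNReal.ofReal M₁ * ‖v‖ₑ * ENNReal.ofReal Λ * ENNReal.ofReal m₁ := by
    rw [ENNReal.ofReal_mul (by positivity), ENNReal.ofReal_mul (by positivity),
      ENNReal.ofReal_mul hM₁, ofReal_norm]
  calc ‖∫ x, ⟪f x, heatExtension (fun y => g y • v) δ x - g x • v⟫‖ₑ
      ≤ ∫⁻ x, ‖⟪f x, heatExtension (fun y => g y • v) δ x - g x • v⟫‖ₑ :=
        enorm_integral_le_lintegral_enorm _
    _ ≤ ∫⁻ x, ENNReal.ofReal M₁ *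
          ∫⁻ z, ENNReal.ofReal (heatKernel δ z) * (‖g (x - z) - g x‖ₑ * ‖v‖ₑ) :=
        lintegral_mono h1
    _ = ENNReal.ofReal M₁ *
          ∫⁻ z, ∫⁻ x, ENNReal.ofReal (heatKernel δ z) * (‖g (x - z) - g x‖ₑ * ‖v‖ₑ) := by
        rw [lintegral_const_mul' _ _ ENNReal.ofReal_ne_top, lintegral_lintegral_swap hmeas]
    _ ≤ ENNReal.ofReal M₁ * ∫⁻ z, ENNReal.ofReal (heatKernel δ z) *
          (ENNReal.ofReal (Λ * ‖z‖) * (2 * volume B) * ‖v‖ₑ) := by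
        gcongr with z
        exact h2 z
    _ = ENNReal.ofReal M₁ * ((∫⁻ z, ENNReal.ofReal (heatKernel δ z * ‖z‖)) *
          (ENNReal.ofReal Λ * (2 * volume B) * ‖v‖ₑ)) := by
        rw [← lintegral_mul_const _ hGm]
        congr 1
        refine lintegral_congr fun z => ?_
        rw [ENNReal.ofReal_mul (heatKernel_pos hδ z).le, ENNReal.ofReal_mul hΛ]
        ring
    _ ≤ ENNReal.ofReal M₁ * (ENNReal.ofReal m₁ * (ENNReal.ofReal Λ * (2 * volume B) * ‖v‖ₑ)) := by
        gcongr
        rw [← ofReal_integral_eq_lintegral_ofReal (integrable_heatKernel_mul_norm hδ)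
          (Eventually.of_forall fun z => mul_nonneg (heatKernel_pos hδ z).le (norm_nonneg _))]
        exact ENNReal.ofReal_le_ofReal (integral_heatKernel_mul_norm_le hδ)
    _ = _ := by
        rw [e]
        ring

/-! ### The Duhamel part: one time slice -/

/-- **Oseen slice estimate.** There is `C₁ = C₁(E) > 0` such that for `σ > 0`, a field `a` bounded
by `M`, `g` continuous with `|g| ≤ 1`, supported in `B`, with increments
`|g(y + z) − g(y)| ≤ min(1, Λ|z|)`, and a vector `v`:
`∫ |∫ ⟪K(σ, x − y)[a(y), a(y)], g(x) v⟫ dx| dy ≤ C₁ M² |v| Λ^{1/2} σ^{-1/4} · 2|B|`.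
The zero mean of the Oseen kernel (`integral_oseenKernel_eq_zero`) replaces `g(x)` by
`g(x) − g(y)`; then Koch–Tataru's bound `|K(σ,z)| ≤ C(σ + |z|²)^{-(d+1)/2}|a||b|`, the substitution
`x = y + z`, Tonelli, the `L¹` modulus of `g` and `min(1, Λ|z|) ≤ Λ^{1/2}(σ + |z|²)^{1/4}`,
`∫ (σ + |z|²)^{-(d/2 + 1/4)} dz = c σ^{-1/4}`. [cite: KochTataruAdvMath2001, §3 (14)] -/
theorem fpl_meanDisp_oseen_slice_le :
    ∃ C₁ : ℝ, 0 < C₁ ∧ ∀ {σ : ℝ}, 0 < σ → ∀ {a : E → E} {M : ℝ}, 0 ≤ M → (∀ y, ‖a y‖ ≤ M) →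
      ∀ {g : E → ℝ}, Continuous g → ∀ {B : Set E}, support g ⊆ B → ∀ {Λ : ℝ}, 0 ≤ Λ →
      (∀ y, |g y| ≤ 1) → (∀ y z, |g (y + z) - g y| ≤ min 1 (Λ * ‖z‖)) → ∀ v : E,
      ∫⁻ y, ‖∫ x, ⟪oseenKernel σ (x - y) (a y) (a y), g x • v⟫‖ₑ ≤
        ENNReal.ofReal (C₁ * M ^ 2 * ‖v‖ * Λ ^ (1 / 2 : ℝ) * σ ^ (-(1 / 4 : ℝ))) *
          (2 * volume B) := by
  set d : ℝ := (Module.finrank ℝ E : ℝ) with hd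
  obtain ⟨C₀, hC₀, hK⟩ := exists_norm_oseenKernel_le (E := E)
  obtain ⟨Ci, -, hKi⟩ := exists_lintegral_enorm_oseenKernel_le (E := E)
  set e₂ : ℝ := (d + 1) / 2 - 1 / 4 with he₂
  have he : d < 2 * e₂ := by rw [he₂]; linarith
  set I : ℝ := ∫ w : E, (1 + ‖w‖ ^ 2) ^ (-e₂) with hI
  have hI0 : 0 < I := integral_one_add_norm_sq_rpow_neg_pos he
  refine ⟨C₀ * I, by positivity, fun {σ} hσ {a M} hM haM {g} hgc {B} hgB {Λ} hΛ hg1 hgΛ v => ?_⟩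
  -- zero mean: replace `g x` by `g x - g y`
  have hzero : ∀ y, ∫ x, ⟪oseenKernel σ (x - y) (a y) (a y), g x • v⟫ =
      ∫ x, ⟪oseenKernel σ (x - y) (a y) (a y), (g x - g y) • v⟫ := by
    intro y
    have hKy : Integrable (fun x => oseenKernel σ (x - y) (a y) (a y)) :=
      (hKi hσ (a y) (a y)).1.comp_sub_right y
    have hI2 : Integrable (fun x => ⟪oseenKernel σ (x - y) (a y) (a y), g y • v⟫) :=
      hKy.inner_const _
    have hI1 : Integrable (fun x => ⟪oseenKernel σ (x - y) (a y) (a y), g x • v⟫) := by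
      have h := (hKy.inner_const v).bdd_mul (c := 1) hgc.aestronglyMeasurable
        (Eventually.of_forall fun x => by rw [Real.norm_eq_abs]; exact hg1 x)
      refine h.congr (Eventually.of_forall fun x => ?_)
      simp only [real_inner_smul_right]
    have h0 : ∫ x, ⟪oseenKernel σ (x - y) (a y) (a y), g y • v⟫ = 0 := by
      calc ∫ x, ⟪oseenKernel σ (x - y) (a y) (a y), g y • v⟫
          = ∫ x, ⟪g y • v, oseenKernel σ (x - y) (a y) (a y)⟫ :=
            integral_congr_ae (Eventually.of_forall fun x => real_inner_comm _ _)
        _ = 0 := by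
            rw [integral_inner hKy,
              integral_sub_right_eq_self (fun z => oseenKernel σ z (a y) (a y)) y,
              integral_oseenKernel_eq_zero, inner_zero_right]
    calc ∫ x, ⟪oseenKernel σ (x - y) (a y) (a y), g x • v⟫
        = (∫ x, ⟪oseenKernel σ (x - y) (a y) (a y), g x • v⟫) -
            ∫ x, ⟪oseenKernel σ (x - y) (a y) (a y), g y • v⟫ := by rw [h0, sub_zero]
      _ = ∫ x, (⟪oseenKernel σ (x - y) (a y) (a y), g x • v⟫ -
            ⟪oseenKernel σ (x - y) (a y) (a y), g y • v⟫) := (integral_sub hI1 hI2).symm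
      _ = _ := by
          refine integral_congr_ae (Eventually.of_forall fun x => ?_)
          simp only [sub_smul, inner_sub_right]
  -- pointwise majorant of the tested kernel
  have hpt : ∀ y x, ‖⟪oseenKernel σ (x - y) (a y) (a y), (g x - g y) • v⟫‖ₑ ≤
      ENNReal.ofReal (C₀ * M ^ 2 * (σ + ‖x - y‖ ^ 2) ^ (-((d + 1) / 2))) *
        ‖g x - g y‖ₑ * ‖v‖ₑ := by
    intro y x
    rw [← ofReal_norm, ← ofReal_norm, ← ofReal_norm, ← ENNReal.ofReal_mul (by positivity),
      ← ENNReal.ofReal_mul (by positivity)]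
    refine ENNReal.ofReal_le_ofReal ?_
    calc ‖⟪oseenKernel σ (x - y) (a y) (a y), (g x - g y) • v⟫‖
        ≤ ‖oseenKernel σ (x - y) (a y) (a y)‖ * ‖(g x - g y) • v‖ := norm_inner_le_norm _ _
      _ ≤ (C₀ * (σ + ‖x - y‖ ^ 2) ^ (-((d + 1) / 2)) * ‖a y‖ * ‖a y‖) * (‖g x - g y‖ * ‖v‖) := by
          rw [norm_smul]
          exact mul_le_mul_of_nonneg_right (hK hσ _ _ _) (by positivity)
      _ ≤ (C₀ * (σ + ‖x - y‖ ^ 2) ^ (-((d + 1) / 2)) * M * M) * (‖g x - g y‖ * ‖v‖) := by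
          gcongr <;> exact haM y
      _ = C₀ * M ^ 2 * (σ + ‖x - y‖ ^ 2) ^ (-((d + 1) / 2)) * ‖g x - g y‖ * ‖v‖ := by ring
  -- the pointwise algebra `W(z) min(1, Λ|z|) ≤ Λ^{1/2} (σ + |z|²)^{-e₂}`
  have halg : ∀ z : E, (σ + ‖z‖ ^ 2) ^ (-((d + 1) / 2)) * min 1 (Λ * ‖z‖) ≤
      Λ ^ (1 / 2 : ℝ) * (σ + ‖z‖ ^ 2) ^ (-e₂) := by
    intro z
    have hρ0 : 0 < σ + ‖z‖ ^ 2 := by positivity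
    have hm0 : 0 ≤ min 1 (Λ * ‖z‖) := le_min zero_le_one (by positivity)
    have hm1 : min 1 (Λ * ‖z‖) ≤ 1 := min_le_left _ _
    have hmΛ : min 1 (Λ * ‖z‖) ≤ Λ * ‖z‖ := min_le_right _ _
    have h4 : min 1 (Λ * ‖z‖) ^ 4 ≤ Λ ^ 2 * (σ + ‖z‖ ^ 2) := by
      calc min 1 (Λ * ‖z‖) ^ 4 = min 1 (Λ * ‖z‖) ^ 2 * min 1 (Λ * ‖z‖) ^ 2 := by ring
        _ ≤ 1 ^ 2 * (Λ * ‖z‖) ^ 2 := by gcongr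
        _ = Λ ^ 2 * ‖z‖ ^ 2 := by ring
        _ ≤ Λ ^ 2 * (σ + ‖z‖ ^ 2) := by gcongr; linarith
    have hmle : min 1 (Λ * ‖z‖) ≤ Λ ^ (1 / 2 : ℝ) * (σ + ‖z‖ ^ 2) ^ (1 / 4 : ℝ) := by
      calc min 1 (Λ * ‖z‖) = (min 1 (Λ * ‖z‖) ^ 4) ^ (1 / 4 : ℝ) := by
            rw [← Real.rpow_natCast, ← Real.rpow_mul hm0]
            norm_num
        _ ≤ (Λ ^ 2 * (σ + ‖z‖ ^ 2)) ^ (1 / 4 : ℝ) :=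
            Real.rpow_le_rpow (by positivity) h4 (by norm_num)
        _ = Λ ^ (1 / 2 : ℝ) * (σ + ‖z‖ ^ 2) ^ (1 / 4 : ℝ) := by
            rw [Real.mul_rpow (sq_nonneg _) hρ0.le, ← Real.rpow_natCast Λ 2,
              ← Real.rpow_mul hΛ]
            norm_num
    calc (σ + ‖z‖ ^ 2) ^ (-((d + 1) / 2)) * min 1 (Λ * ‖z‖)
        ≤ (σ + ‖z‖ ^ 2) ^ (-((d + 1) / 2)) * (Λ ^ (1 / 2 : ℝ) * (σ + ‖z‖ ^ 2) ^ (1 / 4 : ℝ)) :=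
          mul_le_mul_of_nonneg_left hmle (Real.rpow_nonneg hρ0.le _)
      _ = Λ ^ (1 / 2 : ℝ) * ((σ + ‖z‖ ^ 2) ^ (-((d + 1) / 2)) * (σ + ‖z‖ ^ 2) ^ (1 / 4 : ℝ)) := by
          ring
      _ = Λ ^ (1 / 2 : ℝ) * (σ + ‖z‖ ^ 2) ^ (-e₂) := by
          rw [← Real.rpow_add hρ0]
          congr 2
          rw [he₂]
          ring
  -- measurability
  have hgm : ∀ x : E, Measurable fun y : E => ‖g (x + y) - g y‖ₑ := fun x =>
    ((hgc.comp (continuous_const.add continuous_id)).sub hgc).measurable.enorm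
  have hWm : Measurable fun x : E =>
      ENNReal.ofReal (C₀ * M ^ 2 * (σ + ‖x‖ ^ 2) ^ (-((d + 1) / 2))) :=
    (measurable_const.mul ((measurable_const.add (measurable_norm.pow_const 2)).pow_const _)).ennreal_ofReal
  have hW2m : Measurable fun x : E => ENNReal.ofReal ((σ + ‖x‖ ^ 2) ^ (-e₂)) :=
    ((measurable_const.add (measurable_norm.pow_const 2)).pow_const _).ennreal_ofReal
  have hmeas : AEMeasurable (uncurry fun (y x : E) =>
      ENNReal.ofReal (C₀ * M ^ 2 * (σ + ‖x‖ ^ 2) ^ (-((d + 1) / 2))) * ‖g (x + y) - g y‖ₑ * ‖v‖ₑ)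
      ((volume : Measure E).prod volume) := by
    refine Measurable.aemeasurable ?_
    refine ((hWm.comp measurable_snd).mul (Continuous.measurable ?_).enorm).mul measurable_const
    exact (hgc.comp (continuous_snd.add continuous_fst)).sub (hgc.comp continuous_fst)
  have e : ENNReal.ofReal (C₀ * I * M ^ 2 * ‖v‖ * Λ ^ (1 / 2 : ℝ) * σ ^ (-(1 / 4 : ℝ))) =
      ENNReal.ofReal (C₀ * M ^ 2) * ‖v‖ₑ * ENNReal.ofReal (Λ ^ (1 / 2 : ℝ)) *
        ENNReal.ofReal (σ ^ (d / 2 - e₂) * I) := by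
    rw [← ofReal_norm, ← ENNReal.ofReal_mul (by positivity), ← ENNReal.ofReal_mul (by positivity),
      ← ENNReal.ofReal_mul (by positivity)]
    congr 1
    rw [show d / 2 - e₂ = -(1 / 4 : ℝ) by rw [he₂]; ring]
    ring
  -- the main chain
  calc ∫⁻ y, ‖∫ x, ⟪oseenKernel σ (x - y) (a y) (a y), g x • v⟫‖ₑ
      = ∫⁻ y, ‖∫ x, ⟪oseenKernel σ (x - y) (a y) (a y), (g x - g y) • v⟫‖ₑ :=
        lintegral_congr fun y => by rw [hzero y]
    _ ≤ ∫⁻ y, ∫⁻ x, ENNReal.ofReal (C₀ * M ^ 2 * (σ + ‖x - y‖ ^ 2) ^ (-((d + 1) / 2))) *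
          ‖g x - g y‖ₑ * ‖v‖ₑ :=
        lintegral_mono fun y =>
          (enorm_integral_le_lintegral_enorm _).trans (lintegral_mono (hpt y))
    _ = ∫⁻ y, ∫⁻ x, ENNReal.ofReal (C₀ * M ^ 2 * (σ + ‖x‖ ^ 2) ^ (-((d + 1) / 2))) *
          ‖g (x + y) - g y‖ₑ * ‖v‖ₑ := by
        refine lintegral_congr fun y => ?_
        rw [← lintegral_add_right_eq_self _ y]
        simp only [add_sub_cancel_right]
    _ = ∫⁻ x, ∫⁻ y, ENNReal.ofReal (C₀ * M ^ 2 * (σ + ‖x‖ ^ 2) ^ (-((d + 1) / 2))) *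
          ‖g (x + y) - g y‖ₑ * ‖v‖ₑ := lintegral_lintegral_swap hmeas
    _ ≤ ∫⁻ x, ENNReal.ofReal (C₀ * M ^ 2 * (σ + ‖x‖ ^ 2) ^ (-((d + 1) / 2))) *
          (ENNReal.ofReal (min 1 (Λ * ‖x‖)) * (2 * volume B)) * ‖v‖ₑ := by
        refine lintegral_mono fun x => ?_
        rw [lintegral_mul_const _ ((hgm x).const_mul _), lintegral_const_mul _ (hgm x)]
        gcongr
        have h := fpl_meanDisp_lintegral_shift_sub_le hgB x (m := min 1 (Λ * ‖x‖)) (fun y => hgΛ y x)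
        simpa only [add_comm] using h
    _ ≤ ∫⁻ x, ENNReal.ofReal (C₀ * M ^ 2) * ‖v‖ₑ * ENNReal.ofReal (Λ ^ (1 / 2 : ℝ)) *
          ENNReal.ofReal ((σ + ‖x‖ ^ 2) ^ (-e₂)) * (2 * volume B) := by
        refine lintegral_mono fun x => ?_
        have hW0 : 0 ≤ (σ + ‖x‖ ^ 2) ^ (-((d + 1) / 2)) := Real.rpow_nonneg (by positivity) _
        calc ENNReal.ofReal (C₀ * M ^ 2 * (σ + ‖x‖ ^ 2) ^ (-((d + 1) / 2))) *
              (ENNReal.ofReal (min 1 (Λ * ‖x‖)) * (2 * volume B)) * ‖v‖ₑ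
            = ENNReal.ofReal (C₀ * M ^ 2) * ‖v‖ₑ *
                ENNReal.ofReal ((σ + ‖x‖ ^ 2) ^ (-((d + 1) / 2)) * min 1 (Λ * ‖x‖)) *
                (2 * volume B) := by
              rw [ENNReal.ofReal_mul (by positivity), ENNReal.ofReal_mul hW0]
              ring
          _ ≤ ENNReal.ofReal (C₀ * M ^ 2) * ‖v‖ₑ *
                ENNReal.ofReal (Λ ^ (1 / 2 : ℝ) * (σ + ‖x‖ ^ 2) ^ (-e₂)) * (2 * volume B) :=
            by
              gcongr _ * _ * ?_ * _
              exact ENNReal.ofReal_le_ofReal (halg x)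
          _ = _ := by
              rw [ENNReal.ofReal_mul (Real.rpow_nonneg hΛ _)]
              ring
    _ = ENNReal.ofReal (C₀ * M ^ 2) * ‖v‖ₑ * ENNReal.ofReal (Λ ^ (1 / 2 : ℝ)) *
          ENNReal.ofReal (σ ^ (d / 2 - e₂) * I) * (2 * volume B) := by
        rw [lintegral_mul_const _ (hW2m.const_mul _), lintegral_const_mul _ hW2m,
          lintegral_add_norm_sq_rpow_neg he hσ]
    _ = _ := by rw [e]

/-! ### The registered tools sub-goal (`ℝ³`) -/

/-- **Registered tools sub-goal `stub_fplMeanDisplacementTools`** of line `uloc-gronwall-transplant`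
(crux stmt-NavierStokesRegularity-14060): the caloric estimate `fpl_meanDisp_caloric_le` and the
Oseen slice estimate `fpl_meanDisp_oseen_slice_le`, specialised verbatim to `ℝ³`; consumed (in
their general form) by the main file `SymmetryModuliCountFarPastLedgerMeanDisplacement.lean`. [cite: KochTataruAdvMath2001, §3 (14)] -/
theorem stub_fplMeanDisplacementTools :
    (∀ (f : EuclideanSpace ℝ (Fin 3) → EuclideanSpace ℝ (Fin 3)) (M₁ : ℝ), 0 ≤ M₁ → (∀ x, ‖f x‖ ≤ M₁) → ∀ (g : EuclideanSpace ℝ (Fin 3) → ℝ), Continuous g → ∀ (B : Set (EuclideanSpace ℝ (Fin 3))), Function.support g ⊆ B → ∀ (Λ : ℝ), 0 ≤ Λ → (∀ y z, |g (y + z) - g y| ≤ Λ * ‖z‖) → (∀ y, |g y| ≤ 1) → ∀ (v : EuclideanSpace ℝ (Fin 3)) (δ : ℝ), 0 < δ → ‖∫ x, inner ℝ (f x) (Literature.Analysis.UnboundedOperators.heatExtension (fun y => g y • v) δ x - g x • v)‖ₑ ≤ ENNReal.ofReal (M₁ * ‖v‖ * Λ * (2 * (2 : ℝ) ^ ((Module.finrank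 ℝ (EuclideanSpace ℝ (Fin 3)) : ℝ) / 2) * δ ^ (1 / 2 : ℝ))) * (2 * MeasureTheory.volume B)) ∧ (∃ C₁ : ℝ, 0 < C₁ ∧ ∀ (σ : ℝ), 0 < σ → ∀ (a : EuclideanSpace ℝ (Fin 3) → EuclideanSpace ℝ (Fin 3)) (M : ℝ), 0 ≤ M → (∀ y, ‖a y‖ ≤ M) → ∀ (g : EuclideanSpace ℝ (Fin 3) → ℝ), Continuous g → ∀ (B : Set (EuclideanSpace ℝ (Fin 3))), Function.support g ⊆ B → ∀ (Λ : ℝ), 0 ≤ Λ → (∀ y, |g y| ≤ 1) → (∀ y z, |g (y + z) - g y| ≤ min 1 (Λ * ‖z‖)) → ∀ v : EuclideanSpace ℝ (Fin 3), ∫⁻ y, ‖∫ x, inner ℝ (Literature.Analysis.FluidPDE.oseenKernel σ (x - y) (a y) (a y)) (g x • v)‖ₑ ≤ ENNReal.ofReal (C₁ * M ^ 2 * ‖v‖ * Λ ^ (1 / 2 : ℝ) * σ ^ (-(1 / 4 : ℝ))) * (2 * MeasureTheory.volume B)) := by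
  refine ⟨fun f M₁ hM₁ hf g hgc B hgB Λ hΛ hgΛ hg1 v δ hδ =>
    fpl_meanDisp_caloric_le hM₁ hf hgc hgB hΛ hgΛ hg1 v hδ, ?_⟩
  obtain ⟨C₁, hC₁, h⟩ := fpl_meanDisp_oseen_slice_le (E := EuclideanSpace ℝ (Fin 3))
  exact ⟨C₁, hC₁, fun σ hσ a M hM haM g hgc B hgB Λ hΛ hg1 hgΛ v =>
    h hσ hM haM hgc hgB hΛ hg1 hgΛ v⟩

end Summit.NavierStokesRegularity.NavierStokesRegularity.Theorems
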